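import Summits.Ventures.QEC.Census.CNFEncode
import HarnessLib

/-!
# `enc-v1` encoder: completeness of the XOR blocks (direct patterns, Tseitin chain, rows)

Cell `qec`, PARTITION v2 row type-11; soundness lemmas for blocks (1)/(2) of
`Summit.Ventures.QEC.Census.CNFEncode.cnfEncode`: an assignment with the prescribed parities extends,
changing only fresh auxiliaries, to a model of the generated clauses, and the generated clauses mention
only variables below the returned free-variable counter (so later blocks cannot disturb them).
-/

namespace Summit.Ventures.QEC.Census.CNFEncode

open Std.Sat

section Semantics

variable (a b : ℕ → Bool)

/-- Parity is additive over concatenation. -/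
theorem lparity_append (xs ys : List ℕ) :
    lparity a (xs ++ ys) = xor (lparity a xs) (lparity a ys) := by
  induction xs with
  | nil => simp [lparity]
  | cons x xs ih => simp [lparity, ih]

/-- Parity over a list depends only on the values at its entries. -/
theorem lparity_congr {a b} (xs : List ℕ) (h : ∀ x ∈ xs, a x = b x) : lparity a xs = lparity b xs := by
  induction xs with
  | nil => rfl
  | cons x xs ih =>
    simp only [lparity]
    rw [h x (by simp), ih (fun y hy => h y (by simp [hy]))]

/-- Clause evaluation only depends on the variables occurring in the clause. -/
theorem clause_eval_congr {a b : ℕ → Bool} (c : Clause) (h : ∀ l ∈ c, a l.1 = b l.1) :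
    CNF.Clause.eval a c = CNF.Clause.eval b c := by
  induction c with
  | nil => rfl
  | cons l c ih =>
    simp only [CNF.Clause.eval_cons]
    rw [h l (by simp), ih (fun l' hl' => h l' (by simp [hl']))]

/-- A clause all of whose literals are false evaluates to `false`, contrapositively: if the pattern
clause of `q` is false under `a` then `a` follows the pattern `q` on `xs`, so its parity is the
pattern's parity. -/
theorem lparity_eq_patternParity_of_eval_false (xs : List ℕ) (q : ℕ)
    (h : CNF.Clause.eval a (patternClause xs q) = false) : lparity a xs = patternParity xs q := by
  induction xs with
  | nil => rfl
  | cons x xs ih =>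
    simp only [patternClause, CNF.Clause.eval_cons, Bool.or_eq_false_iff] at h
    obtain ⟨h1, h2⟩ := h
    simp only [lparity, patternParity, ih h2]
    have : a x = q.testBit xs.length := by
      revert h1; cases a x <;> cases q.testBit xs.length <;> simp
    rw [this]

/-- DIRECT XOR encoding is complete: an assignment with the prescribed parity satisfies every clause. -/
theorem xorDirect_sound (xs : List ℕ) (p : Bool) (hp : lparity a xs = p) :
    ∀ c ∈ xorDirect xs p, CNF.Clause.eval a c = true := by
  intro c hc
  simp only [xorDirect, List.mem_map, List.mem_filter, List.mem_range] at hc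
  obtain ⟨q, ⟨-, hq⟩, rfl⟩ := hc
  by_contra h
  rw [Bool.not_eq_true] at h
  have := lparity_eq_patternParity_of_eval_false a xs q h
  rw [hp] at this
  rw [← this] at hq
  simp at hq

/-- A pattern clause mentions only the variables of its list. -/
theorem patternClause_vars (xs : List ℕ) (q : ℕ) : ∀ l ∈ patternClause xs q, l.1 ∈ xs := by
  induction xs with
  | nil => simp [patternClause]
  | cons x xs ih =>
    intro l hl
    simp only [patternClause, List.mem_cons] at hl
    rcases hl with rfl | hl
    · simp
    · exact List.mem_cons_of_mem _ (ih l hl)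

/-- Direct XOR clauses mention only the variables of the list. -/
theorem xorDirect_vars (xs : List ℕ) (p : Bool) : ∀ c ∈ xorDirect xs p, ∀ l ∈ c, l.1 ∈ xs := by
  intro c hc
  simp only [xorDirect, List.mem_map, List.mem_filter, List.mem_range] at hc
  obtain ⟨q, -, rfl⟩ := hc
  exact patternClause_vars xs q

/-- Variables of the chain block lie below the returned free-variable counter, which does not
decrease. -/
theorem xorChain_vars (fuel nv : ℕ) (xs : List ℕ) (p : Bool) (hxs : ∀ x ∈ xs, x < nv) :
    nv ≤ (xorChain fuel nv xs p).2 ∧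
      ∀ c ∈ (xorChain fuel nv xs p).1, ∀ l ∈ c, l.1 < (xorChain fuel nv xs p).2 := by
  induction fuel generalizing nv xs with
  | zero =>
    refine ⟨le_rfl, fun c hc l hl => hxs _ (xorDirect_vars xs p c hc l hl)⟩
  | succ fuel ih =>
    simp only [xorChain]
    split
    · exact ⟨le_rfl, fun c hc l hl => hxs _ (xorDirect_vars xs p c hc l hl)⟩
    · have hxs' : ∀ x ∈ nv :: xs.drop 5, x < nv + 1 := by
        intro x hx
        simp only [List.mem_cons] at hx
        rcases hx with rfl | hx
        · omega
        · have := hxs x (List.mem_of_mem_drop hx); omega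
      obtain ⟨ih1, ih2⟩ := ih (nv + 1) (nv :: xs.drop 5) hxs'
      refine ⟨by omega, fun c hc l hl => ?_⟩
      simp only [List.mem_append] at hc
      rcases hc with hc | hc
      · have hmem := xorDirect_vars _ _ c hc l hl
        simp only [List.mem_append, List.mem_singleton] at hmem
        rcases hmem with hmem | rfl
        · have := hxs _ (List.mem_of_mem_take hmem); omega
        · omega
      · exact ih2 c hc l hl

/-- CHAINED XOR encoding is complete: an assignment with the prescribed parity (all variables below the
free counter `nv`) extends, changing only variables `≥ nv`, to a model of the chain clauses. -/
theorem xorChain_sound (fuel nv : ℕ) (xs : List ℕ) (p : Bool) (hxs : ∀ x ∈ xs, x < nv)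
    (hp : lparity a xs = p) :
    ∃ a' : ℕ → Bool, (∀ y < nv, a' y = a y) ∧
      ∀ c ∈ (xorChain fuel nv xs p).1, CNF.Clause.eval a' c = true := by
  induction fuel generalizing nv xs a with
  | zero => exact ⟨a, fun _ _ => rfl, xorDirect_sound a xs p hp⟩
  | succ fuel ih =>
    simp only [xorChain]
    split
    · exact ⟨a, fun _ _ => rfl, xorDirect_sound a xs p hp⟩
    · -- fresh `y := nv` carries the parity of the first five entries
      set hd := xs.take 5 with hhd
      set tl := xs.drop 5 with htl
      let a1 : ℕ → Bool := fun v => if v = nv then lparity a hd else a v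
      have ha1_old : ∀ y < nv, a1 y = a y := by
        intro y hy; simp only [a1]; rw [if_neg (by omega)]
      have ha1_nv : a1 nv = lparity a hd := by simp [a1]
      have hhd_lt : ∀ x ∈ hd, x < nv := fun x hx => hxs x (List.mem_of_mem_take hx)
      have htl_lt : ∀ x ∈ tl, x < nv := fun x hx => hxs x (List.mem_of_mem_drop hx)
      have hpar_hd : lparity a1 hd = lparity a hd :=
        lparity_congr hd (fun x hx => ha1_old x (hhd_lt x hx))
      have hpar_tl : lparity a1 tl = lparity a tl :=
        lparity_congr tl (fun x hx => ha1_old x (htl_lt x hx))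
      have hdirect : lparity a1 (hd ++ [nv]) = false := by
        rw [lparity_append, hpar_hd]
        simp [lparity, ha1_nv]
      have hrest : lparity a1 (nv :: tl) = p := by
        simp only [lparity, ha1_nv, hpar_tl]
        rw [← lparity_append, hhd, htl, List.take_append_drop, hp]
      have hxs' : ∀ x ∈ nv :: tl, x < nv + 1 := by
        intro x hx
        simp only [List.mem_cons] at hx
        rcases hx with rfl | hx
        · omega
        · have := htl_lt x hx; omega
      obtain ⟨a2, ha2_old, ha2_sat⟩ := ih a1 (nv + 1) (nv :: tl) hxs' hrest
      refine ⟨a2, fun y hy => by rw [ha2_old y (by omega), ha1_old y hy], fun c hc => ?_⟩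
      simp only [List.mem_append] at hc
      rcases hc with hc | hc
      · -- a direct clause on `hd ++ [nv]`: variables `< nv + 1`, where `a2 = a1`
        rw [clause_eval_congr c (b := a1) (fun l hl => ?_)]
        · exact xorDirect_sound a1 _ false hdirect c hc
        · have hmem := xorDirect_vars _ _ c hc l hl
          simp only [List.mem_append, List.mem_singleton] at hmem
          rcases hmem with hmem | h
          · exact ha2_old _ (by have := hhd_lt _ hmem; omega)
          · rw [h]; exact ha2_old _ (by omega)
      · exact ha2_sat c hc

/-- Variables of the rows block. -/
theorem encRows_vars (nv : ℕ) (rows : List (List ℕ)) (h : ∀ r ∈ rows, ∀ x ∈ r, x < nv) :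
    nv ≤ (encRows nv rows).2 ∧ ∀ c ∈ (encRows nv rows).1, ∀ l ∈ c, l.1 < (encRows nv rows).2 := by
  induction rows generalizing nv with
  | nil => simp [encRows]
  | cons r rs ih =>
    simp only [encRows]
    obtain ⟨h1, h2⟩ := xorChain_vars r.length nv r false (h r (by simp))
    obtain ⟨h3, h4⟩ := ih (xorChain r.length nv r false).2
      (fun r' hr' x hx => by have := h r' (by simp [hr']) x hx; omega)
    refine ⟨le_trans h1 h3, fun c hc l hl => ?_⟩
    simp only [List.mem_append] at hc
    rcases hc with hc | hc
    · exact lt_of_lt_of_le (h2 c hc l hl) h3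
    · exact h4 c hc l hl

/-- The rows block is complete. -/
theorem encRows_sound (nv : ℕ) (rows : List (List ℕ)) (h : ∀ r ∈ rows, ∀ x ∈ r, x < nv)
    (heven : ∀ r ∈ rows, lparity a r = false) :
    ∃ a' : ℕ → Bool, (∀ y < nv, a' y = a y) ∧
      ∀ c ∈ (encRows nv rows).1, CNF.Clause.eval a' c = true := by
  induction rows generalizing nv a with
  | nil => exact ⟨a, fun _ _ => rfl, by simp [encRows]⟩
  | cons r rs ih =>
    simp only [encRows]
    obtain ⟨a1, ha1_old, ha1_sat⟩ := xorChain_sound a r.length nv r false (h r (by simp)) (heven r (by simp))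
    obtain ⟨hv1, hv2⟩ := xorChain_vars r.length nv r false (h r (by simp))
    have h' : ∀ r' ∈ rs, ∀ x ∈ r', x < (xorChain r.length nv r false).2 :=
      fun r' hr' x hx => by have := h r' (by simp [hr']) x hx; omega
    have heven' : ∀ r' ∈ rs, lparity a1 r' = false := by
      intro r' hr'
      rw [lparity_congr r' (fun x hx => ha1_old x (h r' (by simp [hr']) x hx))]
      exact heven r' (by simp [hr'])
    obtain ⟨a2, ha2_old, ha2_sat⟩ := ih a1 (xorChain r.length nv r false).2 h' heven'
    refine ⟨a2, fun y hy => by rw [ha2_old y (by omega), ha1_old y hy], fun c hc => ?_⟩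
    simp only [List.mem_append] at hc
    rcases hc with hc | hc
    · rw [clause_eval_congr c (b := a1) (fun l hl => ha2_old _ (hv2 c hc l hl))]
      exact ha1_sat c hc
    · exact ha2_sat c hc

end Semantics

end Summit.Ventures.QEC.Census.CNFEncode
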